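import Mathlib.LinearAlgebra.Determinant
import Mathlib.Data.Real.Basic
import Mathlib.Tactic.Module
import HarnessLib

/-!
# The corner frames of the Whitney disc: linear algebra (Milnor 1965, proof of Thm. 6.6)

Topic `Literature/Topology/FourManifolds`.  Milnor, *Lectures on the h-cobordism theorem*
(1965), Theorem 6.6 (PDF pp. 39–45): the hypothesis that the intersection numbers at `p` and
`q` are **opposite** is used exactly once, to see that the positively oriented frames of the
normal bundle of `C'` in `V` determined by `M` at `p` and at `q` can be joined along `C'`
(PDF p. 45, via Lemma 6.13 and the standard model).  In the metric-free ambient formalisation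
(`ComplementaryFrameAlongArc.lean`) this becomes the positivity of one determinant,
`det (T₊ ∘ T₋⁻¹) > 0`, for the two **corner frames**
`T_c = [d(ιφ)(c, 0) | Nf(c, 0) | ∂_w(ι m₂)(c, 0) | ∂_w(ι m₁)(c, 0)]` of `ℝᴺ`, `c = ∓1`.

This file is the pointwise linear algebra at one corner `c`: a factorisation of
`det (T_c ∘ Φ)` (for fixed reference isomorphisms) into
`det [Fr_c | Nf_c]` (tangent/normal reference frame of `V`, joined along the axis by
continuity), `det (P ∘ [U_c | W_c])` (the crossing endomorphism of the two sheets read in a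
chart of `V`; its sign is the local intersection sign up to orientation characters),
`det (dΛ₂(c) R₂) · det (dΛ₁(c) R₁)` (Jacobians of the product parametrisations), the **corner
factor `(2c)⁻¹`** of opposite signs at the two corners (at the corner the disc's `∂_y` is
`(Ċ - Ċ') / (2c)`, `Ċ`, `Ċ'` the velocities of the two arcs), and a non-zero constant depending
on the reference isomorphisms only.

* `Literature.Topology.FourManifolds.cornerFrame_apply_eq` — `T = [Fr | Nf] ∘ (S × id) ∘ perm`;
* `Literature.Topology.FourManifolds.cornerS_apply_eq` — `S = [U | W] ∘ (dΛ₂ × dΛ₁) ∘ M₁ ∘ Sc`;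
* `Literature.Topology.FourManifolds.det_cornerFrame` — the factorisation of `det (T ∘ Φ)`.

Everything is proved; no definitions, no named facts.

## References

* J. Milnor, *Lectures on the h-cobordism theorem*, notes by L. Siebenmann and J. Sondow,
  Princeton Mathematical Notes (1965), Thm. 6.6 and its proof, PDF pp. 39–45.  Held:
  `lit read book:milnornd-lectures-h-cobordism-theorem --pages 39-45`. [MilnorHCobordism1965]
-/

open Set Function Module

noncomputable section

namespace Literature.Topology.FourManifolds

variable {W En Em F₁ F₂ Es Er : Type*}
  [AddCommGroup W] [Module ℝ W]
  [AddCommGroup En] [Module ℝ En] [AddCommGroup Em] [Module ℝ Em]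
  [AddCommGroup F₁] [Module ℝ F₁] [AddCommGroup F₂] [Module ℝ F₂]
  [AddCommGroup Es] [Module ℝ Es] [AddCommGroup Er] [Module ℝ Er]

/-! ### The corner frame as reference frame times `S × id` -/

/-- **`T = [Fr | Nf] ∘ (S × id) ∘ perm`, pointwise.**  For a reference frame `[Fr | Nf]`
(`L` a left inverse of `Fr`) and blocks `D`, `X₂`, `X₁` with values in `range Fr`:
`D w + Nf ν + X₂ f₂ + X₁ f₁ = Fr (L (D w + X₂ f₂ + X₁ f₁)) + Nf ν`. [folklore] -/
theorem cornerFrame_apply_eq (Fr : En →ₗ[ℝ] W) (Nf : Em →ₗ[ℝ] W) (L : W →ₗ[ℝ] En)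
    (hL : ∀ a, L (Fr a) = a) (D : ℝ × ℝ →ₗ[ℝ] W) (X₂ : F₂ →ₗ[ℝ] W) (X₁ : F₁ →ₗ[ℝ] W)
    (hD : LinearMap.range D ≤ LinearMap.range Fr) (hX₂ : LinearMap.range X₂ ≤ LinearMap.range Fr)
    (hX₁ : LinearMap.range X₁ ≤ LinearMap.range Fr) (q : (((ℝ × ℝ) × Em) × F₂) × F₁) :
    (((D.coprod Nf).coprod X₂).coprod X₁) q =
      (Fr.coprod Nf) (L (((D.coprod X₂).coprod X₁) ((q.1.1.1, q.1.2), q.2)), q.1.1.2) := by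
  have hFrL : ∀ t ∈ LinearMap.range Fr, Fr (L t) = t := by
    rintro _ ⟨a, rfl⟩; rw [hL]
  obtain ⟨⟨⟨w, ν⟩, f₂⟩, f₁⟩ := q
  simp only [LinearMap.coprod_apply]
  rw [hFrL _ (Submodule.add_mem _ (Submodule.add_mem _ (hD ⟨w, rfl⟩) (hX₂ ⟨f₂, rfl⟩))
    (hX₁ ⟨f₁, rfl⟩))]
  abel

/-- **`S = [U | W] ∘ (dΛ₂ × dΛ₁) ∘ M₁ ∘ Sc`, pointwise.**  With `D (1,0) = dμ' (1,0)` (the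
axis arc) and `D (0,1) = (2c)⁻¹ (dμ (1,0) - dμ' (1,0))` (at the corner `x = c` the parabola arc
has velocity `D (1, 2c)`), `X₂ = dμ' ∘ inr`, `X₁ = dμ ∘ inr`, and `L dμ' = U dΛ₂`,
`L dμ = W dΛ₁`:
`L (D (h,k) + X₂ f₂ + X₁ f₁) = U (dΛ₂ (h - k/(2c), f₂)) + W (dΛ₁ (k/(2c), f₁))`. [folklore] -/
theorem cornerS_apply_eq (L : W →ₗ[ℝ] En) (dμ' : ℝ × F₂ →ₗ[ℝ] W) (dμ : ℝ × F₁ →ₗ[ℝ] W)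
    (U : Es →ₗ[ℝ] En) (Wm : Er →ₗ[ℝ] En) (dΛ₂ : ℝ × F₂ →ₗ[ℝ] Es) (dΛ₁ : ℝ × F₁ →ₗ[ℝ] Er)
    (hU : L ∘ₗ dμ' = U ∘ₗ dΛ₂) (hWm : L ∘ₗ dμ = Wm ∘ₗ dΛ₁) (c : ℝ) (D : ℝ × ℝ →ₗ[ℝ] W)
    (hD1 : D (1, 0) = dμ' (1, 0)) (hD2 : D (0, 1) = (2 * c)⁻¹ • (dμ (1, 0) - dμ' (1, 0)))
    (q : ((ℝ × ℝ) × F₂) × F₁) :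
    L (((D.coprod (dμ' ∘ₗ LinearMap.inr ℝ ℝ F₂)).coprod (dμ ∘ₗ LinearMap.inr ℝ ℝ F₁)) q) =
      (U.coprod Wm) ((dΛ₂.prodMap dΛ₁)
        ((q.1.1.1 - (2 * c)⁻¹ * q.1.1.2, q.1.2), ((2 * c)⁻¹ * q.1.1.2, q.2))) := by
  obtain ⟨⟨⟨h, k⟩, f₂⟩, f₁⟩ := q
  have hU' : ∀ v, U (dΛ₂ v) = L (dμ' v) := fun v => (LinearMap.congr_fun hU v).symm
  have hW' : ∀ v, Wm (dΛ₁ v) = L (dμ v) := fun v => (LinearMap.congr_fun hWm v).symm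
  have hDhk : D (h, k) = h • D (1, 0) + k • D (0, 1) := by
    rw [← map_smul, ← map_smul, ← map_add]; congr 1; ext <;> simp
  have hμ'a : ∀ (a : ℝ) (f : F₂), dμ' (a, f) = a • dμ' (1, 0) + dμ' (0, f) := fun a f => by
    rw [← map_smul, ← map_add]; congr 1; ext <;> simp
  have hμa : ∀ (a : ℝ) (f : F₁), dμ (a, f) = a • dμ (1, 0) + dμ (0, f) := fun a f => by
    rw [← map_smul, ← map_add]; congr 1; ext <;> simp
  simp only [LinearMap.coprod_apply, LinearMap.prodMap_apply, LinearMap.coe_comp, comp_apply,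
    LinearMap.inr_apply, hU', hW', ← map_add]
  congr 1
  rw [hDhk, hD1, hD2, hμ'a (h - (2 * c)⁻¹ * k), hμa ((2 * c)⁻¹ * k)]
  module

/-! ### The determinant of the corner frame -/

variable [Module.Free ℝ En] [Module.Finite ℝ En] [Module.Free ℝ Em] [Module.Finite ℝ Em]
  [Module.Free ℝ F₁] [Module.Finite ℝ F₁] [Module.Free ℝ F₂] [Module.Finite ℝ F₂]
  [Module.Free ℝ Es] [Module.Finite ℝ Es] [Module.Free ℝ Er] [Module.Finite ℝ Er]

/-- **The corner factorisation** (linear algebra behind Milnor 1965, proof of Thm. 6.6 /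
Lemma 6.13, PDF pp. 44–45).  At a corner `c` of the Whitney disc (`c = ∓1`; the identity is
formal and holds for every `c`, with `0⁻¹ = 0`), with the notation of the
file docstring and arbitrary reference isomorphisms `ΦW`, `Ψ₀`, `P`, `R₂`, `R₁`, `E`, the block
permutation `perm` and the shear `M₁`:
`det (T ∘ ΦW) = det ([Fr | Nf] ∘ Ψ₀) · det (P ∘ [U | W]) · (det (dΛ₂ R₂) · det (dΛ₁ R₁)) · (2c)⁻¹
  · (det (P⁻¹ (R₂⁻¹ × R₁⁻¹) M₁ E) · det (Ψ₀⁻¹ (E⁻¹ × id) perm ΦW))`.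
[cite: MilnorHCobordism1965, proof of Thm. 6.6 and Lemma 6.13 (PDF pp. 44–45)] -/
theorem det_cornerFrame (Fr : En →ₗ[ℝ] W) (Nf : Em →ₗ[ℝ] W) (L : W →ₗ[ℝ] En)
    (hL : ∀ a, L (Fr a) = a) (dμ' : ℝ × F₂ →ₗ[ℝ] W) (dμ : ℝ × F₁ →ₗ[ℝ] W)
    (hμ'T : LinearMap.range dμ' ≤ LinearMap.range Fr)
    (hμT : LinearMap.range dμ ≤ LinearMap.range Fr)
    (U : Es →ₗ[ℝ] En) (Wm : Er →ₗ[ℝ] En) (dΛ₂ : ℝ × F₂ →ₗ[ℝ] Es) (dΛ₁ : ℝ × F₁ →ₗ[ℝ] Er)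
    (hU : L ∘ₗ dμ' = U ∘ₗ dΛ₂) (hWm : L ∘ₗ dμ = Wm ∘ₗ dΛ₁) (c : ℝ)
    (D : ℝ × ℝ →ₗ[ℝ] W) (hDT : LinearMap.range D ≤ LinearMap.range Fr)
    (hD1 : D (1, 0) = dμ' (1, 0)) (hD2 : D (0, 1) = (2 * c)⁻¹ • (dμ (1, 0) - dμ' (1, 0)))
    (ΦW : W ≃ₗ[ℝ] (((ℝ × ℝ) × Em) × F₂) × F₁) (Ψ₀ : W ≃ₗ[ℝ] En × Em) (P : En ≃ₗ[ℝ] Es × Er)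
    (R₂ : Es ≃ₗ[ℝ] ℝ × F₂) (R₁ : Er ≃ₗ[ℝ] ℝ × F₁) (E : En ≃ₗ[ℝ] ((ℝ × ℝ) × F₂) × F₁)
    (perm : ((((ℝ × ℝ) × Em) × F₂) × F₁) ≃ₗ[ℝ] (((ℝ × ℝ) × F₂) × F₁) × Em)
    (hperm : ∀ q, perm q = (((q.1.1.1, q.1.2), q.2), q.1.1.2))
    (M₁ : (((ℝ × ℝ) × F₂) × F₁) ≃ₗ[ℝ] (ℝ × F₂) × (ℝ × F₁))
    (hM₁ : ∀ q, M₁ q = ((q.1.1.1 - q.1.1.2, q.1.2), (q.1.1.2, q.2))) :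
    LinearMap.det ((((D.coprod Nf).coprod (dμ' ∘ₗ LinearMap.inr ℝ ℝ F₂)).coprod
        (dμ ∘ₗ LinearMap.inr ℝ ℝ F₁)) ∘ₗ (ΦW : W →ₗ[ℝ] (((ℝ × ℝ) × Em) × F₂) × F₁)) =
      LinearMap.det ((Fr.coprod Nf) ∘ₗ (Ψ₀ : W →ₗ[ℝ] En × Em)) *
      LinearMap.det ((P : En →ₗ[ℝ] Es × Er) ∘ₗ (U.coprod Wm)) *
      (LinearMap.det (dΛ₂ ∘ₗ (R₂ : Es →ₗ[ℝ] ℝ × F₂)) *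
        LinearMap.det (dΛ₁ ∘ₗ (R₁ : Er →ₗ[ℝ] ℝ × F₁))) *
      (2 * c)⁻¹ *
      (LinearMap.det ((P.symm : Es × Er →ₗ[ℝ] En) ∘ₗ
          ((R₂.symm : ℝ × F₂ →ₗ[ℝ] Es).prodMap (R₁.symm : ℝ × F₁ →ₗ[ℝ] Er)) ∘ₗ
          (M₁ : _ →ₗ[ℝ] (ℝ × F₂) × (ℝ × F₁)) ∘ₗ (E : En →ₗ[ℝ] ((ℝ × ℝ) × F₂) × F₁)) *
        LinearMap.det ((Ψ₀.symm : En × Em →ₗ[ℝ] W) ∘ₗ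
          ((E.symm : (((ℝ × ℝ) × F₂) × F₁) →ₗ[ℝ] En).prodMap (LinearMap.id : Em →ₗ[ℝ] Em)) ∘ₗ
          (perm : _ →ₗ[ℝ] (((ℝ × ℝ) × F₂) × F₁) × Em) ∘ₗ
          (ΦW : W →ₗ[ℝ] (((ℝ × ℝ) × Em) × F₂) × F₁))) := by
  -- notation
  set X₂ : F₂ →ₗ[ℝ] W := dμ' ∘ₗ LinearMap.inr ℝ ℝ F₂ with hX₂
  set X₁ : F₁ →ₗ[ℝ] W := dμ ∘ₗ LinearMap.inr ℝ ℝ F₁ with hX₁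
  set T : ((((ℝ × ℝ) × Em) × F₂) × F₁) →ₗ[ℝ] W := ((D.coprod Nf).coprod X₂).coprod X₁ with hT
  set R : En × Em →ₗ[ℝ] W := Fr.coprod Nf with hR
  set S : (((ℝ × ℝ) × F₂) × F₁) →ₗ[ℝ] En := L ∘ₗ ((D.coprod X₂).coprod X₁) with hS
  set Sc : (((ℝ × ℝ) × F₂) × F₁) →ₗ[ℝ] ((ℝ × ℝ) × F₂) × F₁ :=
    ((LinearMap.id.prodMap ((2 * c)⁻¹ • LinearMap.id)).prodMap LinearMap.id).prodMap LinearMap.id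
    with hSc
  set A : Es × Er →ₗ[ℝ] Es × Er := (P : En →ₗ[ℝ] Es × Er) ∘ₗ (U.coprod Wm) with hA
  set B : Es × Er →ₗ[ℝ] Es × Er :=
    (dΛ₂ ∘ₗ (R₂ : Es →ₗ[ℝ] ℝ × F₂)).prodMap (dΛ₁ ∘ₗ (R₁ : Er →ₗ[ℝ] ℝ × F₁)) with hB
  set G : En →ₗ[ℝ] En := (P.symm : Es × Er →ₗ[ℝ] En) ∘ₗ
    ((R₂.symm : ℝ × F₂ →ₗ[ℝ] Es).prodMap (R₁.symm : ℝ × F₁ →ₗ[ℝ] Er)) ∘ₗ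
    (M₁ : _ →ₗ[ℝ] (ℝ × F₂) × (ℝ × F₁)) ∘ₗ (E : En →ₗ[ℝ] ((ℝ × ℝ) × F₂) × F₁) with hG
  set K₂ : W →ₗ[ℝ] W := (Ψ₀.symm : En × Em →ₗ[ℝ] W) ∘ₗ
    ((E.symm : (((ℝ × ℝ) × F₂) × F₁) →ₗ[ℝ] En).prodMap (LinearMap.id : Em →ₗ[ℝ] Em)) ∘ₗ
    (perm : _ →ₗ[ℝ] (((ℝ × ℝ) × F₂) × F₁) × Em) ∘ₗ
    (ΦW : W →ₗ[ℝ] (((ℝ × ℝ) × Em) × F₂) × F₁) with hK₂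
  have hX₂T : LinearMap.range X₂ ≤ LinearMap.range Fr := by
    rintro _ ⟨f, rfl⟩; exact hμ'T ⟨_, rfl⟩
  have hX₁T : LinearMap.range X₁ ≤ LinearMap.range Fr := by
    rintro _ ⟨f, rfl⟩; exact hμT ⟨_, rfl⟩
  -- (i) `T = R ∘ (S × id) ∘ perm`
  have hTq : ∀ q, T q = R (S (perm q).1, (perm q).2) := fun q => by
    rw [hperm]
    exact cornerFrame_apply_eq Fr Nf L hL D X₂ X₁ hDT hX₂T hX₁T q
  -- (ii) `S = (U ⊕ W) ∘ (dΛ₂ × dΛ₁) ∘ M₁ ∘ Sc`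
  have hSq : ∀ q, S q = (U.coprod Wm) ((dΛ₂.prodMap dΛ₁) (M₁ (Sc q))) := fun q => by
    rw [hM₁]
    have := cornerS_apply_eq L dμ' dμ U Wm dΛ₂ dΛ₁ hU hWm c D hD1 hD2 q
    simp only [hS, LinearMap.coe_comp, comp_apply] at this ⊢
    rw [this]
    simp [hSc]
  -- (iii) the endomorphism factorisations
  have e1 : T ∘ₗ (ΦW : W →ₗ[ℝ] (((ℝ × ℝ) × Em) × F₂) × F₁) =
      (R ∘ₗ (Ψ₀ : W →ₗ[ℝ] En × Em)) ∘ₗ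
      (((Ψ₀.symm : En × Em →ₗ[ℝ] W) ∘ₗ
        ((S ∘ₗ (E : En →ₗ[ℝ] ((ℝ × ℝ) × F₂) × F₁)).prodMap (LinearMap.id : Em →ₗ[ℝ] Em)) ∘ₗ
        (Ψ₀.symm.symm : W →ₗ[ℝ] En × Em)) ∘ₗ K₂) := by
    ext1 w
    simp only [LinearMap.coe_comp, comp_apply, LinearEquiv.coe_coe, hK₂, LinearEquiv.symm_symm,
      LinearEquiv.apply_symm_apply, LinearMap.prodMap_apply, LinearMap.id_apply, hTq]
  have e2 : S ∘ₗ (E : En →ₗ[ℝ] ((ℝ × ℝ) × F₂) × F₁) =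
      ((P.symm : Es × Er →ₗ[ℝ] En) ∘ₗ A ∘ₗ (P.symm.symm : En →ₗ[ℝ] Es × Er)) ∘ₗ
      (((P.symm : Es × Er →ₗ[ℝ] En) ∘ₗ B ∘ₗ (P.symm.symm : En →ₗ[ℝ] Es × Er)) ∘ₗ
        (G ∘ₗ ((E.symm : (((ℝ × ℝ) × F₂) × F₁) →ₗ[ℝ] En) ∘ₗ Sc ∘ₗ
          (E.symm.symm : En →ₗ[ℝ] ((ℝ × ℝ) × F₂) × F₁)))) := by
    ext1 a
    simp only [LinearMap.coe_comp, comp_apply, LinearEquiv.coe_coe, LinearEquiv.symm_symm,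
      LinearEquiv.apply_symm_apply, LinearEquiv.symm_apply_apply, hA, hB, hG, hSq,
      LinearMap.prodMap_apply, LinearMap.coprod_apply]
  -- (iv) determinants
  have hdetSc : LinearMap.det Sc = (2 * c)⁻¹ := by
    simp only [hSc, LinearMap.det_prodMap, LinearMap.det_id, mul_one, one_mul, LinearMap.det_smul,
      Module.finrank_self, pow_one]
  rw [e1, LinearMap.det_comp, LinearMap.det_comp, LinearMap.det_conj, LinearMap.det_prodMap,
    LinearMap.det_id, mul_one, e2, LinearMap.det_comp, LinearMap.det_comp, LinearMap.det_comp,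
    LinearMap.det_conj, LinearMap.det_conj, LinearMap.det_conj, hdetSc]
  simp only [hA, hB, hG, hK₂, LinearMap.det_prodMap]
  ring

end Literature.Topology.FourManifolds
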